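import Literature.MathematicalPhysics.QuantumManyBody.GroundStateFeynmanKacCutLine
import Mathlib.Analysis.Complex.Exponential
import Mathlib.Analysis.SpecialFunctions.Pow.Real
import Mathlib.Tactic

/-!
# Crux-ideate sketch — `TwoReplicaTransienceBound` (stmt-AtomisticToContinuum-9687), ideator 2, round 1

First lemmas of the two idea cards, stated over existing declarations
(`Literature.MathematicalPhysics.QuantumManyBody.BoseGas.{fkSemigroup, Config, Space, box}`):

* card `cut-covariance-static-response`: `mul_exp_neg_mul_le` (recoil weight, PROVED),
  `CutDoubleIntegral`, `CutLaplaceDomination` (the across-the-cut replica coupling is a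
  `u e^{-κu}`-weighted Laplace integral of the bath autocorrelation `u ↦ ⟨a, e^{-uH_n} a⟩`, hence
  dominated by `(eκ)⁻¹ ×` its plain time integral = the static (`H₋₁`) response);
* card `scattering-gauge-soft-encounters`: `gaugeFactor`, `GaugeFactorParticipation` (the
  participation ratio of the `b`-truncated Jastrow gauge factor is `≤ (1 - n·(4π/3)b³/L³)⁻²` for
  EVERY slice `Y`).
-/

noncomputable section

namespace Summit.AtomisticToContinuum.BoseEinsteinCondensation.Cruxes.TwoReplicaTransienceBound.Ideator2

open MeasureTheory Set Filter
open scoped ENNReal NNReal BigOperators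
open Literature.MathematicalPhysics.QuantumManyBody.BoseGas

/-! ## Card 1 — cut-covariance-static-response -/

/-- **Recoil weight bound** `u · e^{-κu} ≤ (e κ)⁻¹` for `κ > 0` and every real `u`: the tagged
particle's own diffusion (`e^{-k²(s+t)}`, `κ = k²`) converts the across-the-cut weight `s + t` into a
bounded factor. Elementary: `κu ≤ e^{κu - 1}` (`Real.add_one_le_exp`). -/
theorem mul_exp_neg_mul_le {κ : ℝ} (hκ : 0 < κ) (u : ℝ) :
    u * Real.exp (-(κ * u)) ≤ (Real.exp 1 * κ)⁻¹ := by
  have h1 : κ * u ≤ Real.exp (κ * u - 1) := by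
    have := Real.add_one_le_exp (κ * u - 1)
    linarith
  have hpos : 0 < Real.exp (κ * u) := Real.exp_pos _
  have hexp : Real.exp (κ * u - 1) = Real.exp (κ * u) / Real.exp 1 := by
    rw [Real.exp_sub]
  rw [hexp] at h1
  have he : 0 < Real.exp 1 := Real.exp_pos 1
  -- κ u ≤ e^{κu}/e  ⇒  u e^{-κu} ≤ 1/(e κ)
  rw [Real.exp_neg]
  rw [le_div_iff₀ he] at h1
  have h2 : u * (Real.exp (κ * u))⁻¹ = (κ * u) / (κ * Real.exp (κ * u)) := by
    field_simp
  rw [h2, div_le_iff₀ (by positivity)]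
  calc κ * u ≤ Real.exp (κ * u) / Real.exp 1 := by
        rw [le_div_iff₀ he]; linarith
    _ = (Real.exp 1 * κ)⁻¹ * (κ * Real.exp (κ * u)) := by
        field_simp

/-- The bath autocorrelation seen through an observable `a ≥ 0` of the slice under the killed,
interaction-weighted `N`-line semigroup: `C_a(u) = ⟨a, e^{-uH_N} a⟩ = ∫ a(X) (e^{-uH_N}a)(X) dX`. -/
def slabCorrelation {N : ℕ} (v : ℝ → ℝ≥0∞) (L : ℝ) (a : Config N → ℝ≥0∞) (u : ℝ) : ℝ≥0∞ :=
  ∫⁻ X, a X * fkSemigroup v L u a X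

/-- **Across-the-cut double integral** (card 1, first identity): the past replica at depth `s` and
the future replica at depth `t` couple through the bath correlation at TOTAL separation `s + t`;
integrating the tagged heat-kernel weights `e^{-κ s} e^{-κ t}` gives the `u e^{-κu}`-weighted Laplace
integral of `C_a` (Tonelli and the change of variables `u = s + t`). -/
def CutDoubleIntegral : Prop :=
  ∀ (N : ℕ) (v : ℝ → ℝ≥0∞), Measurable v → ∀ (L κ : ℝ), 0 < κ →
    ∀ a : Config N → ℝ≥0∞, Measurable a →
      ∫⁻ s in Ioi (0 : ℝ), ∫⁻ t in Ioi (0 : ℝ),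
          ENNReal.ofReal (Real.exp (-(κ * (s + t)))) * slabCorrelation v L a (s + t)
        = ∫⁻ u in Ioi (0 : ℝ), ENNReal.ofReal (u * Real.exp (-(κ * u))) * slabCorrelation v L a u

/-- **Cut Laplace domination** (card 1, FIRST LEMMA): the across-the-cut replica coupling is bounded
by `(eκ)⁻¹ ×` the plain imaginary-time integral of the bath autocorrelation — the STATIC (`H₋₁`)
response of the bath to the observable `a` — with no assumption on HOW FAST `C_a` decays
(pointwise `u e^{-κu} ≤ (eκ)⁻¹`, `mul_exp_neg_mul_le`; the spectral form `(λ+κ)⁻² ≤ (4λκ)⁻¹`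
improves `e⁻¹` to `1/4`). -/
def CutLaplaceDomination : Prop :=
  ∀ (N : ℕ) (v : ℝ → ℝ≥0∞), Measurable v → ∀ (L κ : ℝ), 0 < κ →
    ∀ a : Config N → ℝ≥0∞, Measurable a →
      ∫⁻ u in Ioi (0 : ℝ), ENNReal.ofReal (u * Real.exp (-(κ * u))) * slabCorrelation v L a u
        ≤ ENNReal.ofReal ((Real.exp 1 * κ)⁻¹) * ∫⁻ u in Ioi (0 : ℝ), slabCorrelation v L a u

/-- The domination is immediate from the pointwise weight bound (monotonicity of `∫⁻`). -/
theorem cutLaplaceDomination_holds : CutLaplaceDomination := by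
  intro N v _hv L κ hκ a _ha
  rw [← lintegral_const_mul' _ _ ENNReal.ofReal_ne_top]
  refine lintegral_mono fun u => ?_
  exact mul_le_mul' (ENNReal.ofReal_le_ofReal (mul_exp_neg_mul_le hκ u)) le_rfl

/-! ## Card 2 — scattering-gauge-soft-encounters -/

/-- The one-body shadow of the `b`-truncated Jastrow gauge factor seen by the tagged particle at `x`
in the bath slice `Y`: `F_b(x | Y) = ∏_j f(|x - y_j|)` with `0 ≤ f ≤ 1`, `f ≡ 1` on `[b, ∞)`
(for the line: `f = ` LSY-truncated zero-energy scattering profile, `scatteringProfileLim` cut at `b`). -/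
def gaugeFactor {n : ℕ} (f : ℝ → ℝ) (Y : Config n) (x : Space) : ℝ :=
  ∏ j, f (dist x (Y j))

/-- **Gauge-factor participation bound** (card 2, FIRST LEMMA): for EVERY slice `Y` (no typicality,
no cluster condition) the participation ratio of `x ↦ F_b(x | Y)` over the box is at most
`(L³/(L³ - n·(4π/3)b³))²` — because `F_b ≤ 1` everywhere and `F_b = 1` off the union of the `n`
balls `B(y_j, b)`; with `ρ b³ ≪ 1` this is `1 + O(ρ b³)`: the truncated gauge carries NO long-range
landscape (the `a/r` tail that de-screens the full Jastrow landscape never appears). -/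
def GaugeFactorParticipation : Prop :=
  ∀ (n : ℕ) (L b : ℝ) (f : ℝ → ℝ) (Y : Config n), 0 < L → 0 ≤ b → Measurable f →
    (∀ r, 0 ≤ f r ∧ f r ≤ 1) → (∀ r, b ≤ r → f r = 1) →
    (n : ℝ) * (4 / 3 * Real.pi * b ^ 3) < L ^ 3 →
      ENNReal.ofReal (L ^ 3) * (∫⁻ x in box L, ENNReal.ofReal (gaugeFactor f Y x ^ 2)) /
          (∫⁻ x in box L, ENNReal.ofReal (gaugeFactor f Y x)) ^ 2
        ≤ ENNReal.ofReal ((L ^ 3 / (L ^ 3 - n * (4 / 3 * Real.pi * b ^ 3))) ^ 2)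

/-- The two mass estimates behind `GaugeFactorParticipation`: `∫_Λ F_b² ≤ L³` and
`∫_Λ F_b ≥ L³ - n·(4π/3)b³`. -/
def GaugeFactorMasses : Prop :=
  ∀ (n : ℕ) (L b : ℝ) (f : ℝ → ℝ) (Y : Config n), 0 < L → 0 ≤ b → Measurable f →
    (∀ r, 0 ≤ f r ∧ f r ≤ 1) → (∀ r, b ≤ r → f r = 1) →
      (∫⁻ x in box L, ENNReal.ofReal (gaugeFactor f Y x ^ 2)) ≤ ENNReal.ofReal (L ^ 3) ∧
      ENNReal.ofReal (L ^ 3 - n * (4 / 3 * Real.pi * b ^ 3)) ≤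
        ∫⁻ x in box L, ENNReal.ofReal (gaugeFactor f Y x)

end Summit.AtomisticToContinuum.BoseEinsteinCondensation.Cruxes.TwoReplicaTransienceBound.Ideator2
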